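import Literature.NumberTheory.Automorphic.UnboundedDenominatorsLevelFieldProofs
import HarnessLib

/-!
# The unbounded denominators theorem (Calegari–Dimitrov–Tang) — Theorem 4.3.2: the degree doubling

PROOF-ONLY sequel (no definition, no named fact; D-0026) of the fields instalment
(`UnboundedDenominatorsFields.lean`, `…FieldsProofs.lean`, `…DilationProofs.lean`,
`…LevelFieldProofs.lean`). Source: F. Calegari, V. Dimitrov, Y. Tang, *The unbounded denominators
conjecture*, J. Amer. Math. Soc. **38** (2025), 627–702 = arXiv:2109.09040, §4.3, Theorem 4.3.2
(arXiv v1: Theorem 25) and its proof: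

> **Theorem 4.3.2.** Suppose that there exists an `N` such that `[R_N : M_N] > 1`. Then, for every
> prime `p` not dividing `N`, one has `[R_{Np} : M_{Np}] ≥ 2 [R_N : M_N]`.
> *Proof.* … `[R_{Np} : M_N] = [R_{Np} : R_N M_{Np}] [R_N M_{Np} : M_N] = [R_{Np} : R_N M_{Np}] [R_N : M_N] [M_{Np} : M_N]`,
> because the intersection of `M_{Np}` and `R_N` is `M_N`. Thus `[R_{Np} : M_{Np}]/[R_N : M_N] = [R_{Np} : R_N M_{Np}]`
> is an integer, and it is either `≥ 2` … or `R_{Np} = R_N M_{Np}` [excluded by Theorem 4.3.1].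

## What is proved

The degree identity silently uses the LINEAR DISJOINTNESS of `R_N` and `M_{Np}` over `M_N` (not just
the intersection). We prove it by Dedekind–Artin independence instead of Galois theory:

* §1 **Dedekind independence** (`linearIndepOn_of_smul_invariant`): if a set `S` of automorphisms of
  a field `L` stabilises an intermediate field `A`, and every element of `A` fixed by `S` lies in
  `A₀`, then `S`-FIXED vectors which are linearly independent over `A₀` are linearly independent over
  `A` (minimal relation argument — Mathlib's `FixedPoints.linearIndependent_smul_of_linearIndependent`
  in the form needed here);
* §2 consequently (`relfinrank_le_relfinrank_sup`) `[B : A₀] ≤ [A ⊔ B : A]` whenever `B` is fixed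
  by `S`, `A` is `S`-stable with `A^S ⊆ A₀ ≤ A ⊓ B` (degrees as `IntermediateField.relfinrank`);
* §3 ★ **CDT Theorem 4.3.2** (`two_mul_relfinrank_le`): with `F = M_N`, `A = M_{Np}`, `B = R_N`,
  `E = R_{Np}` and `S = G_N` (the common level group fixing `R_N`, Lemma 4.2.3): granted the
  rationality input `hrat` at levels `N` and `Np` (Shimura 3.52, hypothesis form), the inputs
  `hker₂`/`hcor` of Theorem 4.3.1, finite generation of `R_N` and finiteness of `[R_{Np} : M_N]`:
  **if `R_N ≠ M_N` then `2 · [R_N : M_N] ≤ [R_{Np} : M_{Np}]`.** (`M_{Np}` is `G_N`-stable by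
  `smul_mem_levelField`; `M_{Np}^{G_N} = M_N` by Wohlfahrt and the norm trick
  (`levelField_inf_invariantField_Gamma_le_levelField`); so `[R_N : M_N] ≤ [M_{Np} R_N : M_{Np}]`, and
  `[R_{Np} : M_{Np} R_N] ≥ 2` by the dichotomy `bddDenField_eq_levelField_of_le_sup`.)

## References

* [CalegariDimitrovTang2025] F. Calegari, V. Dimitrov, Y. Tang, The unbounded denominators
  conjecture, J. Amer. Math. Soc. 38 (2025), no. 3, 627–702; arXiv:2109.09040. §4.3 Theorem 4.3.2.
* E. Artin, Galois Theory (1942), Theorem 12 (independence over the fixed field) — folklore input.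
-/

noncomputable section

namespace Literature.NumberTheory.Automorphic

open scoped MatrixGroups ModularForm Manifold
open UpperHalfPlane CongruenceSubgroup Matrix.SpecialLinearGroup ModularGroup

namespace UnboundedDenominators

/-! ### §1. Dedekind independence over a stable subfield -/

/-- **Dedekind–Artin independence.** Let a set `S` of ring automorphisms of a field `L` (elements
of a group `G` acting by `MulSemiringAction`) stabilise the intermediate field `A`, and let `A₀`
contain every `S`-fixed element of `A`. If the elements of a finite set `s ⊆ L` are fixed by `S` and
linearly independent over `A₀`, they are linearly independent over `A`. (Take a relation of `a` in
terms of `s` with coefficients in `A`; applying `g ∈ S` and subtracting gives a relation among `s`,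
so the coefficients are `S`-fixed, i.e. in `A₀`.) [cite: CalegariDimitrovTang2025, Theorem 4.3.2
(proof: "because the intersection of `M_{Np}` and `R_N` is `M_N`")] -/
theorem linearIndepOn_of_smul_invariant {F L : Type*} [Field F] [Field L] [Algebra F L]
    {G : Type*} [Group G] [MulSemiringAction G L] (S : Set G) (A A₀ : IntermediateField F L)
    (hA : ∀ g ∈ S, ∀ a ∈ A, g • a ∈ A) (hA₀ : ∀ a ∈ A, (∀ g ∈ S, g • a = a) → a ∈ A₀)
    {s : Finset L} (hfix : ∀ x ∈ s, ∀ g ∈ S, g • x = x)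
    (hs : LinearIndepOn A₀ id (s : Set L)) : LinearIndepOn A id (s : Set L) := by
  classical
  induction s using Finset.induction_on with
  | empty => simp
  | insert a s has ih =>
    rw [Finset.coe_insert] at hs ⊢
    have has' : a ∉ (s : Set L) := fun h ↦ has (Finset.mem_coe.mp h)
    rw [linearIndepOn_id_insert has'] at hs ⊢
    have hfix' : ∀ x ∈ s, ∀ g ∈ S, g • x = x := fun x hx ↦ hfix x (Finset.mem_insert_of_mem hx)
    have his : LinearIndepOn A id (s : Set L) := ih hfix' hs.1
    refine ⟨his, fun ha ↦ hs.2 ?_⟩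
    -- `a = ∑ f i • i` with `f i ∈ A`
    obtain ⟨f, hf⟩ := Submodule.mem_span_finset'.mp ha
    have hfa : ∑ j : s, ((f j : A) : L) * (j : L) = a := by
      rw [← hf]
      rfl
    -- every coefficient is fixed by `S`
    have hcoef : ∀ (i : s) (g : G), g ∈ S → g • ((f i : A) : L) = f i := by
      intro i g hg
      let c : s → A := fun j ↦ ⟨g • ((f j : A) : L) - f j, sub_mem (hA g hg _ (f j).2) (f j).2⟩
      have hrel : ∑ j : s, c j • (j : L) = 0 := by
        have h1 : g • a = ∑ j : s, (g • ((f j : A) : L)) * (j : L) := by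
          rw [← hfa, Finset.smul_sum]
          refine Finset.sum_congr rfl fun j _ ↦ ?_
          rw [smul_mul', hfix j (Finset.mem_insert_of_mem j.2) g hg]
        have h2 : g • a = a := hfix a (Finset.mem_insert_self a s) g hg
        calc ∑ j : s, c j • (j : L) = ∑ j : s, ((g • ((f j : A) : L)) * (j : L) - (f j : L) * j) := by
              refine Finset.sum_congr rfl fun j _ ↦ ?_
              change ((g • ((f j : A) : L) - f j) : L) * (j : L) = _
              rw [sub_mul]
          _ = g • a - a := by rw [Finset.sum_sub_distrib, h1, hfa]
          _ = 0 := by rw [h2, sub_self]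
      have h0 := Fintype.linearIndependent_iff.mp his c hrel i
      exact sub_eq_zero.mp (congrArg Subtype.val h0)
    -- hence the coefficients lie in `A₀`
    refine Submodule.mem_span_finset'.mpr
      ⟨fun i ↦ ⟨(f i : L), hA₀ _ (f i).2 fun g hg ↦ hcoef i g hg⟩, ?_⟩
    rw [← hfa]
    rfl

/-! ### §2. The degree inequality `[B : A₀] ≤ [A ⊔ B : A]` -/

/-- **`[B : F] ≤ [A ⊔ B : A]` for `F ≤ B` when `B` is fixed by a set `S` of automorphisms
stabilising `A` with `A^S ⊆ F`** — the linear disjointness used in CDT's degree identity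
"`[R_N M_{Np} : M_N] = [R_N : M_N] [M_{Np} : M_N]`", in inequality form and via Dedekind
independence (an `F`-basis of `B` stays `A`-linearly independent in `A ⊔ B`). Degrees are
`IntermediateField.relfinrank X Y = [Y : X]` (for `X ≤ Y`); `A ⊔ B` is assumed finite over `A`.
[cite: CalegariDimitrovTang2025, Theorem 4.3.2 (proof)] -/
theorem relfinrank_le_relfinrank_sup {K L : Type*} [Field K] [Field L] [Algebra K L]
    {G : Type*} [Group G] [MulSemiringAction G L] (S : Set G) (F A B : IntermediateField K L)
    (hFB : F ≤ B) (hA : ∀ g ∈ S, ∀ a ∈ A, g • a ∈ A)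
    (hAF : ∀ a ∈ A, (∀ g ∈ S, g • a = a) → a ∈ F) (hB : ∀ b ∈ B, ∀ g ∈ S, g • b = b)
    (hfin : 0 < IntermediateField.relfinrank A (A ⊔ B)) :
    IntermediateField.relfinrank F B ≤ IntermediateField.relfinrank A (A ⊔ B) := by
  classical
  rw [IntermediateField.relfinrank_eq_finrank_of_le hFB,
    IntermediateField.relfinrank_eq_finrank_of_le (le_sup_left : A ≤ A ⊔ B)] at *
  -- `A ⊔ B` is finite over `A`
  haveI : Module.Finite A (IntermediateField.extendScalars (le_sup_left : A ≤ A ⊔ B)) :=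
    Module.finite_of_finrank_pos hfin
  -- an `F`-basis of `B`, or `[B : F] = 0`
  by_cases hfinB : Module.Finite F (IntermediateField.extendScalars hFB)
  swap
  · rw [Module.finrank_of_not_finite hfinB]
    exact Nat.zero_le _
  haveI : Module.Free F (IntermediateField.extendScalars hFB) := Module.Free.of_divisionRing F _
  let bB := Module.finBasis F (IntermediateField.extendScalars hFB)
  set n := Module.finrank F (IntermediateField.extendScalars hFB) with hn
  -- the basis vectors, in `L`, are `S`-fixed and `F`-independent, hence `A`-independent
  let v : Fin n → L := fun i ↦ ((bB i : IntermediateField.extendScalars hFB) : L)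
  have hvB : ∀ i, v i ∈ B := fun i ↦ (bB i).2
  have hvinj : Function.Injective v := fun i j hij ↦ bB.injective (Subtype.ext hij)
  have hvF : LinearIndependent F v :=
    bB.linearIndependent.map' (IntermediateField.extendScalars hFB).val.toLinearMap
      (LinearMap.ker_eq_bot.mpr Subtype.val_injective)
  -- as a finite set
  let s : Finset L := Finset.univ.image v
  have hcoe : (s : Set L) = Set.range v := by
    rw [Finset.coe_image, Finset.coe_univ, Set.image_univ]
  have hsF : LinearIndepOn F id (s : Set L) := by
    rw [hcoe]
    exact (linearIndepOn_id_range_iff hvinj).mpr hvF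
  have hsfix : ∀ x ∈ s, ∀ g ∈ S, g • x = x := by
    intro x hx g hg
    obtain ⟨i, -, rfl⟩ := Finset.mem_image.mp hx
    exact hB _ (hvB i) g hg
  have hsA : LinearIndepOn A id (s : Set L) :=
    linearIndepOn_of_smul_invariant S A F hA hAF hsfix hsF
  have hvA : LinearIndependent A v := by
    rw [hcoe] at hsA
    exact (linearIndepOn_id_range_iff hvinj).mp hsA
  -- transport into `A ⊔ B` viewed over `A`
  let w : Fin n → IntermediateField.extendScalars (le_sup_left : A ≤ A ⊔ B) :=
    fun i ↦ ⟨v i, (le_sup_right : B ≤ A ⊔ B) (hvB i)⟩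
  have hw : LinearIndependent A w :=
    LinearIndependent.of_comp
      (IntermediateField.extendScalars (le_sup_left : A ≤ A ⊔ B)).val.toLinearMap hvA
  calc n = Fintype.card (Fin n) := (Fintype.card_fin n).symm
    _ ≤ Module.finrank A (IntermediateField.extendScalars (le_sup_left : A ≤ A ⊔ B)) :=
        hw.fintype_card_le_finrank

/-! ### §3. CDT Theorem 4.3.2 -/

/-- Both factors of a positive product of naturals are positive. [folklore] -/
private theorem pos_and_pos_of_mul_pos {m n : ℕ} (h : 0 < m * n) : 0 < m ∧ 0 < n := by
  rcases Nat.eq_zero_or_pos m with rfl | hm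
  · simp at h
  rcases Nat.eq_zero_or_pos n with rfl | hn
  · simp at h
  exact ⟨hm, hn⟩

/-- ★ **CDT Theorem 4.3.2 (degree doubling)** [cite: CalegariDimitrovTang2025, Theorem 4.3.2]:
"Suppose that `[R_N : M_N] > 1`. Then, for every prime `p` not dividing `N`, one has
`[R_{Np} : M_{Np}] ≥ 2 [R_N : M_N]`." Here with the tree's fields (`levelField = M ⊗ ℂ`,
`bddDenField = R ⊗ ℂ`, degrees as `IntermediateField.relfinrank`), granted: the two inputs `hker₂`,
`hcor` of Theorem 4.3.1 at `(N, p)` (amalgam + congruence subgroup property of `SL₂(ℤ[1/p])`;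
Corollary 4.5.3), the rationality input at levels `N` and `Np` (Shimura 3.52, hypothesis form),
finite generation of `R_N` and finiteness of `[R_{Np} : M_N]` (CDT: all finite over `M_2 = ℚ(λ)` by
the holonomy bound). Proof: `R_N` is fixed by the common level group `G_N` (Lemma 4.2.3), `M_{Np}`
is `G_N`-stable with `M_{Np}^{G_N} ⊆ M_N` (Wohlfahrt + norm trick), so by Dedekind independence
`[R_N : M_N] ≤ [M_{Np} R_N : M_{Np}]`; and `[R_{Np} : M_{Np} R_N] ≥ 2` because `R_{Np} = M_{Np} R_N`
would force `R_N = M_N` (Theorem 4.3.1, `bddDenField_eq_levelField_of_le_sup`). -/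
theorem two_mul_relfinrank_le {N p : ℕ} (hN : N ≠ 0) (hp : p.Prime) (hNp : N.Coprime p)
    {A : GL (Fin 2) ℝ} (hA : (A : Matrix (Fin 2) (Fin 2) ℝ) = !![(p : ℝ), 0; 0, 1])
    (hker₂ : ∀ (Δ : Type) [Group Δ] [Finite Δ] (g₁ g₂ : Gamma N →* Δ),
      (∀ (x : SL(2, ℤ)) (hx : x ∈ Gamma N), x ∈ Gamma0 p → ∀ (y : SL(2, ℤ)) (hy : y ∈ Gamma N),
        A * mapGL ℝ x = mapGL ℝ y * A → g₁ ⟨x, hx⟩ = g₂ ⟨y, hy⟩) →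
      (∃ M : ℕ, M ≠ 0 ∧ ∀ (x : SL(2, ℤ)) (hx : x ∈ Gamma N), x ∈ Gamma M → g₁ ⟨x, hx⟩ = 1) ∧
      (∃ M : ℕ, M ≠ 0 ∧ ∀ (x : SL(2, ℤ)) (hx : x ∈ Gamma N), x ∈ Gamma M → g₂ ⟨x, hx⟩ = 1))
    (hcor : ∀ (Q : Type) [CommGroup Q] [Finite Q] (θ : Gamma N →* Q),
      (∀ g : SL(2, ℤ), ∃ M : ℕ, M ≠ 0 ∧ ∀ (x : SL(2, ℤ)) (hx : x ∈ Gamma N)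
        (hgx : g * x * g⁻¹ ∈ Gamma N), x ∈ Gamma M → θ ⟨g * x * g⁻¹, hgx⟩ = θ ⟨x, hx⟩) →
      ∃ M : ℕ, M ≠ 0 ∧ ∀ (x : SL(2, ℤ)) (hx : x ∈ Gamma N), x ∈ Gamma M → θ ⟨x, hx⟩ = 1)
    (hratN : ∀ (m : ℕ) (F : ModularForm ((Gamma N : Subgroup SL(2, ℤ)) : Subgroup (GL (Fin 2) ℝ))
      (12 * (m : ℤ))), algebraMap hol Mer (modFun m F) ∈ levelField N)
    (hratNp : ∀ (m : ℕ) (F : ModularForm ((Gamma (N * p) : Subgroup SL(2, ℤ)) :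
      Subgroup (GL (Fin 2) ℝ)) (12 * (m : ℤ))), algebraMap hol Mer (modFun m F) ∈ levelField (N * p))
    (hfg : (bddDenField N).FG)
    (hfin : 0 < IntermediateField.relfinrank (levelField N) (bddDenField (N * p)))
    (hne : bddDenField N ≠ levelField N) :
    2 * IntermediateField.relfinrank (levelField N) (bddDenField N) ≤
      IntermediateField.relfinrank (levelField (N * p)) (bddDenField (N * p)) := by
  have hNp0 : N * p ≠ 0 := mul_ne_zero hN hp.ne_zero
  have hN' : 0 < N := Nat.pos_of_ne_zero hN
  -- the four fields and their inclusions
  have hFA : levelField N ≤ levelField (N * p) := levelField_mono hN' (dvd_mul_right N p) hNp0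
  have hFB : levelField N ≤ bddDenField N := levelField_le_bddDenField N
  have hAE : levelField (N * p) ≤ bddDenField (N * p) := levelField_le_bddDenField (N * p)
  have hBE : bddDenField N ≤ bddDenField (N * p) := bddDenField_mono hN' (dvd_mul_right N p) hNp0
  have hSE : levelField (N * p) ⊔ bddDenField N ≤ bddDenField (N * p) := sup_le hAE hBE
  -- the common level group fixing `R_N` (Lemma 4.2.3)
  obtain ⟨GN, hGNfi, -, -, -, hGNT, -, hGNle⟩ :=
    exists_commonLevel_bddDenField_le_invariantField hN hfg
  haveI := hGNfi
  -- `M_{Np}` is `G_N`-stable, with `G_N`-fixed part inside `M_N`; `R_N` is `G_N`-fixed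
  have hstab : ∀ g ∈ (GN : Set SL(2, ℤ)), ∀ a ∈ levelField (N * p), g • a ∈ levelField (N * p) :=
    fun g _ a ha ↦ smul_mem_levelField hNp0 hratNp g ha
  have hfixA : ∀ a ∈ levelField (N * p), (∀ g ∈ (GN : Set SL(2, ℤ)), g • a = a) →
      a ∈ levelField N := by
    intro a ha hga
    have haG : a ∈ invariantField GN := mem_invariantField_iff.mpr fun γ hγ ↦ hga γ hγ
    have haN : a ∈ invariantField (Gamma N) :=
      levelField_inf_invariantField_le hGNT hNp0 (IntermediateField.mem_inf.mpr ⟨ha, haG⟩)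
    exact levelField_inf_invariantField_Gamma_le_levelField hN hNp0 hratN
      (IntermediateField.mem_inf.mpr ⟨ha, haN⟩)
  have hfixB : ∀ b ∈ bddDenField N, ∀ g ∈ (GN : Set SL(2, ℤ)), g • b = b :=
    fun b hb γ hγ ↦ mem_invariantField_iff.mp (hGNle hb) γ hγ
  -- the tower `M_N ≤ M_{Np} ≤ M_{Np} R_N ≤ R_{Np}` and positivity of the degrees
  have htower₁ := IntermediateField.relfinrank_mul_relfinrank hFA hAE
  have htower₂ := IntermediateField.relfinrank_mul_relfinrank
    (le_sup_left : levelField (N * p) ≤ levelField (N * p) ⊔ bddDenField N) hSE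
  have hposAE : 0 < IntermediateField.relfinrank (levelField (N * p)) (bddDenField (N * p)) := by
    rw [← htower₁] at hfin
    exact (pos_and_pos_of_mul_pos hfin).2
  have hpos₁ : 0 < IntermediateField.relfinrank (levelField (N * p))
      (levelField (N * p) ⊔ bddDenField N) := by
    rw [← htower₂] at hposAE
    exact (pos_and_pos_of_mul_pos hposAE).1
  have hpos₂ : 0 < IntermediateField.relfinrank (levelField (N * p) ⊔ bddDenField N)
      (bddDenField (N * p)) := by
    rw [← htower₂] at hposAE
    exact (pos_and_pos_of_mul_pos hposAE).2
  -- Step 1 (Dedekind): `[R_N : M_N] ≤ [M_{Np} R_N : M_{Np}]`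
  have h1 : IntermediateField.relfinrank (levelField N) (bddDenField N) ≤
      IntermediateField.relfinrank (levelField (N * p)) (levelField (N * p) ⊔ bddDenField N) :=
    relfinrank_le_relfinrank_sup (GN : Set SL(2, ℤ)) (levelField N) (levelField (N * p))
      (bddDenField N) hFB hstab hfixA hfixB hpos₁
  -- Step 2 (Theorem 4.3.1): `[R_{Np} : M_{Np} R_N] ≥ 2`
  have h2 : 2 ≤ IntermediateField.relfinrank (levelField (N * p) ⊔ bddDenField N)
      (bddDenField (N * p)) := by
    by_contra hlt
    have h1' : IntermediateField.relfinrank (levelField (N * p) ⊔ bddDenField N)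
        (bddDenField (N * p)) = 1 := by omega
    rw [IntermediateField.relfinrank_eq_one_iff] at h1'
    exact hne (bddDenField_eq_levelField_of_le_sup hN hp hNp hA hker₂ hcor hfg h1')
  -- assemble
  calc 2 * IntermediateField.relfinrank (levelField N) (bddDenField N)
      ≤ IntermediateField.relfinrank (levelField (N * p) ⊔ bddDenField N) (bddDenField (N * p)) *
        IntermediateField.relfinrank (levelField (N * p)) (levelField (N * p) ⊔ bddDenField N) :=
        Nat.mul_le_mul h2 h1
    _ = IntermediateField.relfinrank (levelField (N * p)) (bddDenField (N * p)) := by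
        rw [mul_comm, htower₂]

end UnboundedDenominators

end Literature.NumberTheory.Automorphic

end
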